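import Summits.HodgeConjecture.HodgeConjecture.Theorems.SixfoldTableXCensusWeilRow17AllMembers
import Literature.AlgebraicGeometry.HodgeTheory.WeilTypeFivefoldTimesCMCurveBlockDataSocket
import HarnessLib

/-!
# TABLE X (dimension 6) — ROW 17 `g6.ExY5.(3,2)` (`A ∼ Y₅ × E_k`), EVERY MEMBER, RE-KEYED ON MEMBER-DEFINING DATA ONLY:
# the blocked socket's block data DERIVED for the constructed blocking endomorphism `φ_E := diag(φ_Y, 2χ)`
# (cell `pub-hodgeav-hg6`, req-37 (A) Q2b; eng-3 g4, brick E17c; lead g4 GO 2026-08-29T10:43:39Z)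

HONEST FRAMING. HC, `HC_AV` (stmt-1333), `HC_CM` (stmt-3052) and H2 are NOT proved and do not occur. X2 ∕ X1 stay `@[conjecture]`
(OURS); `WeilSixfolds` (stmt-HodgeConjecture-2524), R-W6 and Markman₆ (preprint, unrefereed) appear only as displayed hypotheses
of §2. KERNEL ONLY: theorems over existing declarations; no definition, no `sorry`, no named fact; restates nothing.

WHAT CHANGES w.r.t. R17-C (`SixfoldTableXCensusWeilRow17AllMembers`): there, the blocked socket's data (`φ_E`, `hEcard`, `μ`, `hinj`,
`hdist`, `hWne`, `htop`, `hKE`, `hKE'`) were DISPLAYED binders (member data in generator form). Here the blocking endomorphism is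
CONSTRUCTED, `φ_E := diag(φ_Y, 2χ) = blockDiag Y E φY (2 • χ)` with colours `μ k = (k+1)·i√d` on `ι = Fin 2`, and all seven data
are THEOREMS of E17a ∕ E17b (`WeilTypeFivefoldTimesCMCurveBlockData[Socket]`: two-factor Künneth eigenvector lemma, the four blocks
`pr₁^* W_{±i√d}(φ_Y)`, `pr₂^* W_{±i√d}(χ)` are non-zero, span, and lie in `W_{±i√d}(Φ)`; `finrank_ℚ End⁰(Y × E) = 4` from
`Hom(Y, E) = 0` and `finrank_ℚ End⁰(E) = 2` for the CM curve, `finrank_endAlgebra_eq_two_of_cmCurve`), with NO added datum (lead g4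
ruling 11:04:51Z). `Y` simple and non-CM are DERIVED from `End⁰(Y) = k` (`VanGeemen1994.isSimple_of_finrank_endAlgebra_eq_two` ∕ `not_isOfCMType_of_finrank_endAlgebra_eq_two`).
STANDING OF THE REMAINING DISPLAYED DATA (lead g4 ruling 10:43:39Z): Milne's single-generator data `hC` ∕ `hdiag` ∕ `J'` ∕ `hJ'` ∕
`hJQ` — now stated for the constructed generator `φ_E = diag(φ_Y, 2χ)` of `End⁰(Y × E) = k × k` (minimal polynomial
`(x² + d)(x² + 4d)` of degree `4 = [End⁰ : ℚ]`) — and the class data `hQ` ∕ `hK` ∕ `hφQ` stay displayed exactly as on rows 11 ∕ 19: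
they are member ∕ class data of record, not Lie- or group-theoretic hypotheses. «Special members = ∅» for row 17.

## References
* [MoonenZarhin1999LowDim] B. Moonen, Yu. Zarhin, Math. Ann. 315 (1999), Thm. 0.2, §2 (2.4), §5 (5.2), (5.3), (5.11).
* [Milne1999LefschetzClasses] J. S. Milne, Duke Math. J. 96 (1999), §2 pp. 645–650, Thm. 3.2 and Cor. 4.5.
* [vanGeemen1994HodgeAV] B. van Geemen, LNM 1594 (1994), Lemma 3.7, Thm. 4.9 and Thm. 6.12.
* [Deligne1982HodgeCycles] P. Deligne, LNM 900 (1982), I §3 Prop. 3.4 and 3.6.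
-/

set_option linter.dupNamespace false

noncomputable section

open scoped TensorProduct
open CategoryTheory CategoryTheory.Limits
open Literature.AlgebraicGeometry Literature.AlgebraicGeometry.Motives
open Literature.AlgebraicGeometry.Motives.AbelianVariety
open Literature.AlgebraicGeometry.Motives.HodgeStructure
open Literature.AlgebraicGeometry.HodgeTheory
open Literature.AlgebraicGeometry.Milne1999
open Literature.AlgebraicGeometry.Milne1999.CMTypeProducts (blockDiag)
open Literature.AlgebraicGeometry.VanGeemen1994 (pullbackOne hodgeGroupOne detOnEigenspace hodgeClassSpan)
open Literature.AlgebraicTopology.SingularHomology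
open Literature.Barriers.HodgeConjecture
open Summit.HodgeConjecture.HodgeConjecture.Ring2.ClassTargets
open Summit.HodgeConjecture.HodgeConjecture.Ring2.Motiv (ProdCMCell)
open Summit.HodgeConjecture.HodgeConjecture.Ring2.Atlas (IsQuarticFieldTypeIVFourfold)

namespace Summit.HodgeConjecture.HodgeConjecture.TableX.WeilERows

variable {Y E : AbelianVariety ℂ} {h : complexBetti (Y.prod E).X 2}

/-! ## §0 `hG` at `Y₅ × E_k` from member-defining data -/

/-- **`hG` FOR ROW 17 AT `Y₅ × E_k`, socket data DERIVED**: R17-C's `hG_of_fivefold_prod_cmCurve` at the constructed blocking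
endomorphism `φ_E := diag(φ_Y, 2χ)`, `ι = Fin 2`, `μ k = (k+1)·i√d`, with `hEcard` ∕ `hinj` ∕ `hdist` ∕ `hWne` ∕ `htop` ∕ `hKE` ∕
`hKE'` supplied by E17a ∕ E17b. Displayed: member-defining data and the class data `hQ` ∕ `hK` ∕ `hφQ` only. HC NOT proved.
[cite: MoonenZarhin1999LowDim, §2 (2.4) and §5 (5.2), (5.3), (5.11)] [cite: Deligne1982HodgeCycles, I §3 Prop. 3.4 and 3.6] -/
theorem hG_of_fivefold_prod_cmCurve_blockDiag
    (hY5 : Y.dim = 5) (φY : Y ⟶ Y) {d : ℕ} (hd : 0 < d) (hφY : φY ≫ φY = -(d • 𝟙 Y))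
    (hE2 : Module.finrank ℚ Y.endAlgebra = 2)
    (h23 : eigenMultiplicity Y φY (Complex.I * (Real.sqrt d : ℂ)) = 2 ∨
      eigenMultiplicity Y φY (Complex.I * (Real.sqrt d : ℂ)) = 3)
    (hE1 : E.dim = 1) (χ : E ⟶ E) (hχ : χ ≫ χ = -(d • 𝟙 E))
    (Φ : Y.prod E ⟶ Y.prod E) (hΦ₁ : Φ ≫ fst Y E = fst Y E ≫ φY) (hΦ₂ : Φ ≫ snd Y E = snd Y E ≫ χ)
    (hW : IsWeilType (Y.prod E) Φ 3 d)
    (hQ : IsRationalClass h) (hK : ∃ s : ℝ, 0 < s ∧ IsKaehlerClass (Y.prod E).dim (Y.prod E).X ((s : ℂ) • h))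
    (hφQ : ∀ x y, polarizationPairingOne (Y.prod E).X h ((Y.prod E).dim - 1) (pullbackOne (Y.prod E) Φ x)
        (pullbackOne (Y.prod E) Φ y) = (d : ℂ) • polarizationPairingOne (Y.prod E).X h ((Y.prod E).dim - 1) x y) :
    ∀ (u : complexBetti (Y.prod E).X 1 ≃ₗ[ℂ] complexBetti (Y.prod E).X 1) (hu : u ∈ unitaryCentralizerGroup (Y.prod E) h),
      detOnEigenspace u (pullbackOne (Y.prod E) Φ) (fun x ↦ (mem_centralizerGroup_iff.1 hu.1) Φ x)
        (Complex.I * (Real.sqrt d : ℂ)) = 1 → u ∈ hodgeGroupOne (Y.prod E).dim (Y.prod E).X :=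
  hG_of_fivefold_prod_cmCurve hY5 φY hd hφY hE2 h23 hE1 χ hχ Φ hΦ₁ hΦ₂ hW (blockDiag Y E φY (2 • χ))
    (CMCurveFivefold.finrank_endAlgebra_prod_eq hY5 hd hφY hE2 hE1 hχ)
    (fun k : Fin 2 => (((k : ℕ) : ℂ) + 1) * (Complex.I * (Real.sqrt d : ℂ)))
    (CMCurveFivefold.colour_injective hd) (CMCurveFivefold.colour_ne_conj hd)
    (CMCurveFivefold.eigenspace_block_ne_bot hd (by omega) (by omega) hφY hχ)
    (CMCurveFivefold.iSup_eigenspace_block_eq_top hd hφY hχ)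
    (CMCurveFivefold.eigenspace_block_le_weil hd hφY hχ hΦ₁ hΦ₂)
    (CMCurveFivefold.eigenspace_block_conj_le_weil hd hφY hχ hΦ₁ hΦ₂) hQ hK hφQ

/-! ## §1 Row 17, every member `A' ∼ Y₅ × E_k`: the census on the isogeny class, re-keyed -/

/-- **TABLE X ROW 17 — EVERY MEMBER `A' ∼ Y₅ × E_k`, KERNEL VERDICT WITH DOMAIN MEMBERSHIP ON THE ISOGENY CLASS, binders =
member-defining data + Milne's generator data for `φ_E = diag(φ_Y, 2χ)` + class data, NO added datum**: R17-C's
`census_row17_of_isIsogenous_fivefold_prod_cmCurve` with the socket data and `hYs` ∕ `hYcm` DISCHARGED. Conclusion = L17's verbatim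
at `A'`. «Special members = ∅». HC NOT proved. [cite: MoonenZarhin1999LowDim, Thm. 0.2, §2 (2.4), §5 (5.3), (5.11)]
[cite: Milne1999LefschetzClasses, Thm. 3.2 and Cor. 4.5] [cite: vanGeemen1994HodgeAV, Lemma 3.7 and Thm. 6.12] -/
theorem census_row17_of_isIsogenous_fivefold_prod_cmCurve_blockDiag {A' : AbelianVariety ℂ}
    (hY5 : Y.dim = 5) (φY : Y ⟶ Y) {d : ℕ} (hd : 0 < d) (hφY : φY ≫ φY = -(d • 𝟙 Y))
    (hE2 : Module.finrank ℚ Y.endAlgebra = 2)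
    (h23 : eigenMultiplicity Y φY (Complex.I * (Real.sqrt d : ℂ)) = 2 ∨
      eigenMultiplicity Y φY (Complex.I * (Real.sqrt d : ℂ)) = 3)
    (hE1 : E.dim = 1) (χ : E ⟶ E) (hχ : χ ≫ χ = -(d • 𝟙 E))
    (Φ : Y.prod E ⟶ Y.prod E) (hΦ₁ : Φ ≫ fst Y E = fst Y E ≫ φY) (hΦ₂ : Φ ≫ snd Y E = snd Y E ≫ χ)
    (hW : IsWeilType (Y.prod E) Φ 3 d)
    (hC : centralizerAlgebra (Y.prod E) = Subalgebra.centralizer ℂ {pullbackOne (Y.prod E) (blockDiag Y E φY (2 • χ))})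
    (hdiag : ⨆ m : ℂ, Module.End.eigenspace (pullbackOne (Y.prod E) (blockDiag Y E φY (2 • χ))) m = ⊤)
    (hQ : IsRationalClass h) (hK : ∃ s : ℝ, 0 < s ∧ IsKaehlerClass (Y.prod E).dim (Y.prod E).X ((s : ℂ) • h))
    (J' : Module.End ℂ (complexBetti (Y.prod E).X 1))
    (hJ' : J' ∈ Subalgebra.centralizer ℂ (centralizerAlgebra (Y.prod E) : Set (Module.End ℂ (complexBetti (Y.prod E).X 1))))
    (hJQ : ∀ x y : complexBetti (Y.prod E).X 1,
      polarizationPairingOne (Y.prod E).X h ((Y.prod E).dim - 1) (pullbackOne (Y.prod E) (blockDiag Y E φY (2 • χ)) x) y =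
        polarizationPairingOne (Y.prod E).X h ((Y.prod E).dim - 1) x (J' y))
    (hφQ : ∀ x y, polarizationPairingOne (Y.prod E).X h ((Y.prod E).dim - 1) (pullbackOne (Y.prod E) Φ x)
        (pullbackOne (Y.prod E) Φ y) = (d : ℂ) • polarizationPairingOne (Y.prod E).X h ((Y.prod E).dim - 1) x y)
    (hA'A : IsIsogenous A' (Y.prod E)) :
    (A'.dim = 6 ∧ ¬ (IsOfCMType A' ∨ ProdCMCell IsQuarticFieldTypeIVFourfold (fun Z ↦ Z.dim = 2) A')) ∧
    (∀ c : complexBetti A'.X (2 * 2), IsRationalClass c → IsOfHodgeType A'.dim A'.X (2 * 2) 2 2 c →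
      c ∈ divisorClassesSpan A'.X A'.dim 2 ⊔ Submodule.span ℂ {w' : complexBetti A'.X (2 * 2) |
        ∃ (C : AbelianVariety ℂ) (g : A'.X ⟶ C.X) (w : complexBetti C.X (2 * 2)), C.dim < A'.dim ∧
          IsRationalClass w ∧ IsOfHodgeType C.dim C.X (2 * 2) 2 2 w ∧ w' = complexBetti.map g (2 * 2) w}) ∧
    (∀ c : complexBetti A'.X (2 * 3), IsRationalClass c → IsOfHodgeType A'.dim A'.X (2 * 3) 3 3 c →
      c ∈ divisorClassesSpan A'.X A'.dim 3 ⊔ Submodule.span ℂ {w' : complexBetti A'.X (2 * 3) |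
          ∃ (a : complexBetti A'.X (2 * 2)) (b : complexBetti A'.X (2 * 1)),
            IsRationalClass a ∧ IsOfHodgeType A'.dim A'.X (2 * 2) 2 2 a ∧ IsRationalClass b ∧
            IsOfHodgeType A'.dim A'.X (2 * 1) 1 1 b ∧ w' = cupProduct (two_mul_add_two_mul 2 1) a b} ⊔
        Submodule.span ℂ {w' : complexBetti A'.X (2 * 3) |
          ∃ (C : AbelianVariety ℂ) (g : A'.X ⟶ C.X) (w : complexBetti C.X (2 * 3)), C.dim < A'.dim ∧
            IsRationalClass w ∧ IsOfHodgeType C.dim C.X (2 * 3) 3 3 w ∧ w' = complexBetti.map g (2 * 3) w} ⊔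
        Submodule.span ℂ {w' : complexBetti A'.X (2 * 3) |
          ∃ (B' : AbelianVariety ℂ) (g : A'.X ⟶ B'.X) (d : ℕ) (ψ : B' ⟶ B') (w : complexBetti B'.X (2 * 3)),
            B'.dim = 6 ∧ 0 < d ∧ ψ ≫ ψ = -(d • 𝟙 B') ∧ IsRationalClass w ∧
            IsOfHodgeType B'.dim B'.X (2 * 3) 3 3 w ∧ w ∈ weilClassesOf B' ψ 3 d ∧
            w' = complexBetti.map g (2 * 3) w}) := by
  haveI : HodgeTensorFacts.{0, 0} := hodgeTensorFacts_holds
  have hYs : Y.IsSimple := VanGeemen1994.isSimple_of_finrank_endAlgebra_eq_two (by omega) hd hφY hE2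
  have hYcm : ¬ IsOfCMType Y := VanGeemen1994.not_isOfCMType_of_finrank_endAlgebra_eq_two (by omega) hd hφY hE2
  exact census_row17_of_isIsogenous_fivefold_prod_cmCurve hYs hYcm hY5 φY hd hφY hE2 h23 hE1 χ hχ Φ hΦ₁ hΦ₂ hW
    (blockDiag Y E φY (2 • χ)) (CMCurveFivefold.finrank_endAlgebra_prod_eq hY5 hd hφY hE2 hE1 hχ)
    (fun k : Fin 2 => (((k : ℕ) : ℂ) + 1) * (Complex.I * (Real.sqrt d : ℂ)))
    (CMCurveFivefold.colour_injective hd) (CMCurveFivefold.colour_ne_conj hd)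
    (CMCurveFivefold.eigenspace_block_ne_bot hd (by omega) (by omega) hφY hχ)
    (CMCurveFivefold.iSup_eigenspace_block_eq_top hd hφY hχ)
    (CMCurveFivefold.eigenspace_block_le_weil hd hφY hχ hΦ₁ hΦ₂)
    (CMCurveFivefold.eigenspace_block_conj_le_weil hd hφY hχ hΦ₁ hΦ₂) hC hdiag hQ hK J' hJ' hJQ hφQ hA'A

/-! ## §2 HC at every row-17 member ⟸ the DISPLAYED residue binders, re-keyed -/

/-- **HC for every `A' ∼ Y₅ × E_k` of row 17 ⟸ the ladder item `WeilSixfolds` (stmt-HodgeConjecture-2524, DISPLAYED, not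
asserted)**, binders = member-defining data + generator ∕ class data. HC NOT proved unconditionally.
[cite: vanGeemen1994HodgeAV, 2.4, Lemma 3.7 and Thm. 6.12] [cite: Milne1999LefschetzClasses, Cor. 4.5]
[cite: MoonenZarhin1999LowDim, Thm. 0.2 and §5 (5.11)] -/
theorem hodgeConjectureFor_of_isIsogenous_row17_blockDiag_of_weilSixfolds {A' : AbelianVariety ℂ}
    (hW₆ : Theses.SevenfoldWeilCensus.WeilSixfolds)
    (hY5 : Y.dim = 5) (φY : Y ⟶ Y) {d : ℕ} (hd : 0 < d) (hφY : φY ≫ φY = -(d • 𝟙 Y))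
    (hE2 : Module.finrank ℚ Y.endAlgebra = 2)
    (h23 : eigenMultiplicity Y φY (Complex.I * (Real.sqrt d : ℂ)) = 2 ∨
      eigenMultiplicity Y φY (Complex.I * (Real.sqrt d : ℂ)) = 3)
    (hE1 : E.dim = 1) (χ : E ⟶ E) (hχ : χ ≫ χ = -(d • 𝟙 E))
    (Φ : Y.prod E ⟶ Y.prod E) (hΦ₁ : Φ ≫ fst Y E = fst Y E ≫ φY) (hΦ₂ : Φ ≫ snd Y E = snd Y E ≫ χ)
    (hW : IsWeilType (Y.prod E) Φ 3 d)
    (hC : centralizerAlgebra (Y.prod E) = Subalgebra.centralizer ℂ {pullbackOne (Y.prod E) (blockDiag Y E φY (2 • χ))})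
    (hdiag : ⨆ m : ℂ, Module.End.eigenspace (pullbackOne (Y.prod E) (blockDiag Y E φY (2 • χ))) m = ⊤)
    (hQ : IsRationalClass h) (hK : ∃ s : ℝ, 0 < s ∧ IsKaehlerClass (Y.prod E).dim (Y.prod E).X ((s : ℂ) • h))
    (J' : Module.End ℂ (complexBetti (Y.prod E).X 1))
    (hJ' : J' ∈ Subalgebra.centralizer ℂ (centralizerAlgebra (Y.prod E) : Set (Module.End ℂ (complexBetti (Y.prod E).X 1))))
    (hJQ : ∀ x y : complexBetti (Y.prod E).X 1,
      polarizationPairingOne (Y.prod E).X h ((Y.prod E).dim - 1) (pullbackOne (Y.prod E) (blockDiag Y E φY (2 • χ)) x) y =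
        polarizationPairingOne (Y.prod E).X h ((Y.prod E).dim - 1) x (J' y))
    (hφQ : ∀ x y, polarizationPairingOne (Y.prod E).X h ((Y.prod E).dim - 1) (pullbackOne (Y.prod E) Φ x)
        (pullbackOne (Y.prod E) Φ y) = (d : ℂ) • polarizationPairingOne (Y.prod E).X h ((Y.prod E).dim - 1) x y)
    (hA'A : IsIsogenous A' (Y.prod E)) : HodgeConjectureFor A'.dim A'.X := by
  haveI : HodgeTensorFacts.{0, 0} := hodgeTensorFacts_holds
  exact HodgeConjectureFor.of_isIsogenous hA'A
    (hodgeConjectureFor_weilType_generalE_of_weilSixfolds (Y.prod E) Φ d hW₆ hW (blockDiag Y E φY (2 • χ)) hC hdiag hQ hK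
      J' hJ' hJQ hφQ (hG_of_fivefold_prod_cmCurve_blockDiag hY5 φY hd hφY hE2 h23 hE1 χ hχ Φ hΦ₁ hΦ₂ hW hQ hK hφQ))

/-- **HC for every `A' ∼ Y₅ × E_k` of row 17 ⟸ {Markman₆ (preprint, UNREFEREED), R-W6 (OPEN)}, both DISPLAYED**, re-keyed.
HC NOT proved unconditionally. [cite: Markman2025SecantWeil, Thm. 1.5.1 (preprint, unrefereed)]
[claim: Markman2025SurveySecant, status: under-review] [cite: vanGeemen1994HodgeAV, Lemma 3.7 and Thm. 6.12] -/
theorem hodgeConjectureFor_of_isIsogenous_row17_blockDiag_of_markman₆_nonsplit {A' : AbelianVariety ℂ}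
    (hMark₆ : Markman2025_weilClasses_algebraic_hyperbolicSixfold) (hRW6 : WeilTypeLadder.NonsplitSixfolds)
    (hY5 : Y.dim = 5) (φY : Y ⟶ Y) {d : ℕ} (hd : 0 < d) (hφY : φY ≫ φY = -(d • 𝟙 Y))
    (hE2 : Module.finrank ℚ Y.endAlgebra = 2)
    (h23 : eigenMultiplicity Y φY (Complex.I * (Real.sqrt d : ℂ)) = 2 ∨
      eigenMultiplicity Y φY (Complex.I * (Real.sqrt d : ℂ)) = 3)
    (hE1 : E.dim = 1) (χ : E ⟶ E) (hχ : χ ≫ χ = -(d • 𝟙 E))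
    (Φ : Y.prod E ⟶ Y.prod E) (hΦ₁ : Φ ≫ fst Y E = fst Y E ≫ φY) (hΦ₂ : Φ ≫ snd Y E = snd Y E ≫ χ)
    (hW : IsWeilType (Y.prod E) Φ 3 d)
    (hC : centralizerAlgebra (Y.prod E) = Subalgebra.centralizer ℂ {pullbackOne (Y.prod E) (blockDiag Y E φY (2 • χ))})
    (hdiag : ⨆ m : ℂ, Module.End.eigenspace (pullbackOne (Y.prod E) (blockDiag Y E φY (2 • χ))) m = ⊤)
    (hQ : IsRationalClass h) (hK : ∃ s : ℝ, 0 < s ∧ IsKaehlerClass (Y.prod E).dim (Y.prod E).X ((s : ℂ) • h))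
    (J' : Module.End ℂ (complexBetti (Y.prod E).X 1))
    (hJ' : J' ∈ Subalgebra.centralizer ℂ (centralizerAlgebra (Y.prod E) : Set (Module.End ℂ (complexBetti (Y.prod E).X 1))))
    (hJQ : ∀ x y : complexBetti (Y.prod E).X 1,
      polarizationPairingOne (Y.prod E).X h ((Y.prod E).dim - 1) (pullbackOne (Y.prod E) (blockDiag Y E φY (2 • χ)) x) y =
        polarizationPairingOne (Y.prod E).X h ((Y.prod E).dim - 1) x (J' y))
    (hφQ : ∀ x y, polarizationPairingOne (Y.prod E).X h ((Y.prod E).dim - 1) (pullbackOne (Y.prod E) Φ x)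
        (pullbackOne (Y.prod E) Φ y) = (d : ℂ) • polarizationPairingOne (Y.prod E).X h ((Y.prod E).dim - 1) x y)
    (hA'A : IsIsogenous A' (Y.prod E)) : HodgeConjectureFor A'.dim A'.X := by
  haveI : HodgeTensorFacts.{0, 0} := hodgeTensorFacts_holds
  exact HodgeConjectureFor.of_isIsogenous hA'A
    (hodgeConjectureFor_weilType_generalE_of_markman₆_nonsplit (Y.prod E) Φ d hMark₆ hRW6 hW (blockDiag Y E φY (2 • χ)) hC
      hdiag hQ hK J' hJ' hJQ hφQ (hG_of_fivefold_prod_cmCurve_blockDiag hY5 φY hd hφY hE2 h23 hE1 χ hχ Φ hΦ₁ hΦ₂ hW hQ hK hφQ))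

end Summit.HodgeConjecture.HodgeConjecture.TableX.WeilERows

end
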